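import Summits.BirchSwinnertonDyer.BirchSwinnertonDyer.Theorems.KolyvaginDepthDoorDepthTableKuriharaESide5
import Summits.BirchSwinnertonDyer.BirchSwinnertonDyer.Theorems.KolyvaginDepthDoorDepthTableRankTwo707a1TwistBSDQuotient
import Literature.NumberTheory.EllipticCurves.BSDSelmerPConverseSerreProofs
import HarnessLib

/-!
# Route `KolyvaginDepthDoor`, crux `KolyvaginDepthSupplyKN` (stmt-BirchSwinnertonDyer-22820) —
# DEPTH TABLE v19, ROW `707a1` @ `(11, d_K = −19)`: the SOCKET for the fleet's twist record in Kurihara currency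
# (twist model `T₀ = [0, -1, 1, -4452, -110483]` = `707a1^{(−19)}`, conductor `255227`)

Helper file of the lead prover of line `levelone` (kdd-p1 g23; `--supports stmt-BirchSwinnertonDyer-22820
--as helper`); it closes nothing and BSD is NOT proved by it. Same template as `…KuriharaSocket794a1`, at the row's prime `p = 11`
(`707a1 = [0,1,1,−12,12]`, `N = 707 = 7·101`; the E-side record of the lineage sits at `11` (and `13`), `11` split in `K = ℚ(√−19)`).

The E-side of this row is in the tree (g21: `C707a1.sha_inf_torsionBy_eq_bot_of_kuriharaClaim_11` — `Ш(707a1)[11] = 0` from the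
record `cert_707a1` @ `(11, 463·1277)`, claim `hδE`); every side condition of `E = 707a1` and of the minimal twist model `T₀`
at `p = 11` is a kernel theorem of the lineage or of this file (`goodOrdinary_11`, `hasSurjectiveModNGaloisRep_11` + Serre,
`nonAnomalous_11`, `kodairaNeron_of_five_le 11`, `spadeOne_of_five_le 11`, `heegner_neg19`, `2 ≤ rank` by
`KernelCerts002.C707a1.two_le_rank`; `minTwist19_isElliptic/_isGloballyMinimal/_smul_eq`; Kodaira–Néron of `T₀` at `11` below). What is OWED is
one datum on `T₀`:

* `minTwist19_card_11`, `minTwist19_nonAnomalous_11`, `minTwist19_kodairaNeron_11` — `#T̃₀(𝔽_11) = 16`, `a_11(T₀) = −4 ≢ 1 (mod 11)`;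
  `11 ∤ ord_v(Δ_{T₀})` at multiplicative `v` (`Δ(T₀) = 7²·19⁶·101`) (kernel).
* `cruxBody_of_twistKuriharaClaim_11_neg19` — **THE SOCKET**: for every `K` with `d_K = −19`, IF some cyclic Kolyvagin level `m`
  of `(T₀, 11)` with `ν(m) ≤ 2` carries a unit mod-`11` Kurihara number (the CLAIM of a future tree record `cert_<T₀>` at `(11, m)`,
  hypothesis `hδT`), THEN the clause of `KolyvaginDepthSupplyKN` holds at `W = 707a1` verbatim (v17's `cruxBody_of_kuriharaClaims_spade`
  with every other input discharged; Kim Thm. 1.11, modularity, Mazur Cor. 4.1, W. Zhang L8.4 (1)/9.1 BY NAME). Candidate cyclic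
  Kolyvagin primes of `(T₀, 11)` (CLOSING-DATA-v18 §2b): `463, 1277`.
* (no exact depth-one reading here: the lineage's exact row for `707a1` is typed at `(5, −19)`, not at `11`; the generic
  `…KuriharaExactRow` applies once an exact row at `11` is.)

CONDITIONAL on the named facts displayed (`hKim`, `hnf`, `hMaz`, `h84`) and on the record claims; per curve; nothing class-wide;
BSD is NOT proved by any of this.

References: [Kim2022StructureSelmer] Thm. 1.11, §1.2.2; [WZhang2014] Lemma 8.4 (1), Thm. 9.1; [GrossLMS1991] Prop. 3.7 (2);
[Mazur1978] Cor. 4.1; [Serre1972] §4.2; [CremonaAlgorithms1997] Table 1 (707a1); [SilvermanAEC2009] VII.3.1, X.4.2, X.5 Cor. 5.4.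
-/

set_option linter.dupNamespace false

noncomputable section

open scoped Classical NumberField

namespace Summit.BirchSwinnertonDyer.BirchSwinnertonDyer.Theorems.KolyvaginDepthDoor

open Literature.NumberTheory.EllipticCurves Literature.NumberTheory.EllipticCurves.ModularForms
  WeierstrassCurve NumberField IsDedekindDomain
open Summit.BirchSwinnertonDyer.BirchSwinnertonDyer.Theorems
open Summit.BirchSwinnertonDyer.BirchSwinnertonDyer.Rank2Observatory
open Summit.BirchSwinnertonDyer.BirchSwinnertonDyer.Rank1Residual (IntModel.frobeniusTrace_eq)
open Summit.BirchSwinnertonDyer.Rank1Residual.Supersingular (natCard_point_eq_of_countPoints countPoints_eq_of_fast)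
open Summit.BirchSwinnertonDyer.Rank1Residual.Additive

namespace C707a1

/-- `#T̃₀(𝔽_11) = 16` for the twist model `T₀ = [0, -1, 1, -4452, -110483]` (`a_11(T₀) = −4 = a_11(E)`, as `11` splits in
`ℚ(√−19)`), kernel-decided (`countPointsFast`). [cite: SilvermanAEC2009, V.2] -/
theorem minTwist19_card_11 :
    Nat.card (((⟨0, -1, 1, -4452, -110483⟩ : WeierstrassCurve ℤ).map (Int.castRingHom (ZMod 11))).toAffine.Point) = 16 :=
  haveI : Fact (Nat.Prime 11) := ⟨by norm_num⟩
  natCard_point_eq_of_countPoints 0 (-1) 1 (-4452) (-110483) 11 (by norm_num) (by decide +kernel) (n := 16)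
    (countPoints_eq_of_fast (by decide +kernel))

/-- **`11` is non-anomalous for the twist model `T₀ = [0, -1, 1, -4452, -110483]`**: `a_11(T₀) = −4`, `11 ∤ a_11(T₀) − 1`
(Sakamoto's hypothesis (c) / Kim's (iii) for `T₀`). [cite: SilvermanAEC2009, VII.3 Prop. 3.1] -/
theorem minTwist19_nonAnomalous_11 :
    haveI := minTwist19_isGloballyMinimal; haveI := Fact.mk (by norm_num : Nat.Prime 11);
    ¬ ((11 : ℕ) : ℤ) ∣ ((⟨0, -1, 1, -4452, -110483⟩ : WeierstrassCurve ℤ).map (Int.castRingHom ℚ)).frobeniusTrace 11 - 1 := by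
  haveI := minTwist19_isElliptic
  haveI := minTwist19_isGloballyMinimal
  haveI := Fact.mk (by norm_num : Nat.Prime 11)
  rw [IntModel.frobeniusTrace_eq minTwist19_intModel minTwist19_card_11]
  decide

/-- **Kodaira–Néron for `T₀ = [0, -1, 1, -4452, -110483]` at `11`**: `11 ∤ ord_v(Δ_{T₀})` at every multiplicative place
(`Δ(T₀) = 232830065069 = 7²·19⁶·101 < 188^11`; exponents `2, 6, 1`, none divisible by `11`; table lemma
`not_dvd_ordMinimalDiscriminant_of_intModel_table`, as `minTwist19_kodairaNeron_5`). [cite: SilvermanAEC2009, VII.5.1, VIII.8] -/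
theorem minTwist19_kodairaNeron_11 :
    haveI := minTwist19_isElliptic; haveI := minTwist19_isGloballyMinimal;
    ∀ v : HeightOneSpectrum (𝓞 ℚ),
      ((⟨0, -1, 1, -4452, -110483⟩ : WeierstrassCurve ℤ).map (Int.castRingHom ℚ)).HasMultiplicativeReductionAt v →
      ¬ 11 ∣ ((⟨0, -1, 1, -4452, -110483⟩ : WeierstrassCurve ℤ).map (Int.castRingHom ℚ)).ordMinimalDiscriminant v := by
  haveI := minTwist19_isElliptic
  haveI := minTwist19_isGloballyMinimal
  exact not_dvd_ordMinimalDiscriminant_of_intModel_table minTwist19_intModel (p := 11) (Δ₀ := 232830065069)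
    (by decide +kernel) (B := 188) (by decide +kernel)
    (by
      intro q hq hqP hqd
      have hn : ((232830065069 : ℤ).natAbs) = 7 ^ 2 * (19 ^ 6 * (101 ^ 1)) := by norm_num
      rw [hn] at hqd ⊢
      rcases (Nat.Prime.dvd_mul hqP).mp hqd with h | h0
      · obtain rfl := (Nat.prime_dvd_prime_iff_eq hqP (by norm_num)).mp (hqP.dvd_of_dvd_pow h)
        exact ⟨2, by simp, by decide +kernel, by decide +kernel, by norm_num⟩
      · rcases (Nat.Prime.dvd_mul hqP).mp h0 with h | h1
        · obtain rfl := (Nat.prime_dvd_prime_iff_eq hqP (by norm_num)).mp (hqP.dvd_of_dvd_pow h)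
          exact ⟨6, by simp, by decide +kernel, by decide +kernel, by norm_num⟩
        · obtain rfl := (Nat.prime_dvd_prime_iff_eq hqP (by norm_num)).mp (hqP.dvd_of_dvd_pow h1)
          exact ⟨1, by simp, by decide +kernel, by decide +kernel, by norm_num⟩)

/-- **THE SOCKET for row `707a1` @ `(11, −19)`: the clause of `KolyvaginDepthSupplyKN` at `W = 707a1` from the EXISTING
E-side record claim and ONE FUTURE twist record claim.** For every imaginary quadratic `K` with `d_K = −19`: granted
Kim Thm. 1.11 (`hKim`), modularity (`hnf`), Mazur Cor. 4.1 (`hMaz`), W. Zhang L8.4 (1)/9.1 (`h84`) BY NAME, the claim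
`hδE` of the tree record `cert_707a1` @ `(11, 591251 = 463·1277)`, and — THE DATUM OWED — a cyclic Kolyvagin level `m` of
`(T₀, 11)` (`hm`) of depth `ν(m) ≤ 2` (`hμ`) whose claim `hδT` holds, the crux's clause holds at `707a1` VERBATIM. CONDITIONAL
on the four named facts and the two claims; per curve; BSD is not proved by it.
[cite: Kim2022StructureSelmer, Thm. 1.11 (PDF p. 8)] [cite: WZhang2014, Lemma 8.4 (1) (p. 236), Thm. 9.1 (p. 240)]
[cite: Mazur1978, Cor. 4.1] [cite: CremonaAlgorithms1997, Table 1 (707a1)] -/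
theorem cruxBody_of_twistKuriharaClaim_11_neg19
    (hKim : Kim2022_card_selmerGroup_le_pow_of_kuriharaNumber_ne_zero)
    (hnf : exists_isNewformOf) (hMaz : mazur_not_dvd_maninConstant_of_odd)
    (h84 : Literature.NumberTheory.EllipticCurves.WZhang2014_lemma84_exists_minimal_kolyvaginClass_one_selmerCard)
    (K : Type) [Field K] [NumberField K] (hK : IsImaginaryQuadratic K) (hD : NumberField.discr K = -19)
    (hδE : haveI := isElliptic_c707a1; haveI := isGloballyMinimal_c707a1;
      haveI : NeZero (((⟨0, 1, 1, -12, 12⟩ : WeierstrassCurve ℤ).map (Int.castRingHom ℚ)).conductorNorm ℤ) := neZero_conductorNorm_of_isElliptic _;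
      haveI := Fact.mk (by norm_num : Nat.Prime 11);
      ∀ (D : ModularParametrizationData ((⟨0, 1, 1, -12, 12⟩ : WeierstrassCurve ℤ).map (Int.castRingHom ℚ)) (((⟨0, 1, 1, -12, 12⟩ : WeierstrassCurve ℤ).map (Int.castRingHom ℚ)).conductorNorm ℤ)), ¬ ((11 : ℕ) : ℤ) ∣ D.maninConstant →
        (∃ u : ℚ, ‖(u : ℚ_[11])‖ = 1 ∧ ((⟨0, 1, 1, -12, 12⟩ : WeierstrassCurve ℤ).map (Int.castRingHom ℚ)).realPeriodRat = u * plusPeriod D.f) →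
        ∃ ψ : (ℓ : ℕ) → (ZMod ℓ)ˣ →* Multiplicative (ZMod 11),
          (∀ ℓ ∈ (591251 : ℕ).primeFactors, Function.Surjective (ψ ℓ)) ∧ kuriharaNumber D.f 11 591251 ψ ≠ 0)
    (m : ℕ) [NeZero m]
    (hm : haveI := minTwist19_isGloballyMinimal;
      IsCyclicKolyvaginLevel ((⟨0, -1, 1, -4452, -110483⟩ : WeierstrassCurve ℤ).map (Int.castRingHom ℚ)) 11 m)
    (hμ : m.primeFactors.card ≤ 2)
    (hδT : haveI := minTwist19_isElliptic; haveI := minTwist19_isGloballyMinimal;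
      haveI : NeZero (((⟨0, -1, 1, -4452, -110483⟩ : WeierstrassCurve ℤ).map (Int.castRingHom ℚ)).conductorNorm ℤ) :=
        neZero_conductorNorm_of_isElliptic _;
      haveI := Fact.mk (by norm_num : Nat.Prime 11);
      ∀ (D : ModularParametrizationData ((⟨0, -1, 1, -4452, -110483⟩ : WeierstrassCurve ℤ).map (Int.castRingHom ℚ))
          (((⟨0, -1, 1, -4452, -110483⟩ : WeierstrassCurve ℤ).map (Int.castRingHom ℚ)).conductorNorm ℤ)),
        ¬ ((11 : ℕ) : ℤ) ∣ D.maninConstant →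
        (∃ u : ℚ, ‖(u : ℚ_[11])‖ = 1 ∧
          ((⟨0, -1, 1, -4452, -110483⟩ : WeierstrassCurve ℤ).map (Int.castRingHom ℚ)).realPeriodRat = u * plusPeriod D.f) →
        ∃ ψ : (ℓ : ℕ) → (ZMod ℓ)ˣ →* Multiplicative (ZMod 11),
          (∀ ℓ ∈ m.primeFactors, Function.Surjective (ψ ℓ)) ∧ kuriharaNumber D.f 11 m ψ ≠ 0) :
    haveI := isElliptic_c707a1; haveI := isGloballyMinimal_c707a1;
    ∃ (p : ℕ) (hp : Fact p.Prime), 5 ≤ p ∧ ((⟨0, 1, 1, -12, 12⟩ : WeierstrassCurve ℤ).map (Int.castRingHom ℚ)).HasGoodReductionAtPrime p ∧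
      ¬ (p : ℤ) ∣ ((⟨0, 1, 1, -12, 12⟩ : WeierstrassCurve ℤ).map (Int.castRingHom ℚ)).frobeniusTrace p ∧
      (∀ n : ℕ, ((⟨0, 1, 1, -12, 12⟩ : WeierstrassCurve ℤ).map (Int.castRingHom ℚ)).HasSurjectiveModNGaloisRep (p ^ n : ℕ)) ∧
      (∀ v : HeightOneSpectrum (𝓞 ℚ), ((⟨0, 1, 1, -12, 12⟩ : WeierstrassCurve ℤ).map (Int.castRingHom ℚ)).HasMultiplicativeReductionAt v →
        ¬ p ∣ ((⟨0, 1, 1, -12, 12⟩ : WeierstrassCurve ℤ).map (Int.castRingHom ℚ)).ordMinimalDiscriminant v) ∧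
      ∃ (K : Type) (_ : Field K) (_ : NumberField K), IsImaginaryQuadratic K ∧
        NumberField.discr K ≠ -3 ∧ NumberField.discr K ≠ -4 ∧
        ∃ (_ : NeZero (((⟨0, 1, 1, -12, 12⟩ : WeierstrassCurve ℤ).map (Int.castRingHom ℚ)).conductorNorm ℤ)),
          SatisfiesHeegnerHypothesis (((⟨0, 1, 1, -12, 12⟩ : WeierstrassCurve ℤ).map (Int.castRingHom ℚ)).conductorNorm ℤ) K ∧
        ∃ (Dt : ModularParametrizationData ((⟨0, 1, 1, -12, 12⟩ : WeierstrassCurve ℤ).map (Int.castRingHom ℚ)) (((⟨0, 1, 1, -12, 12⟩ : WeierstrassCurve ℤ).map (Int.castRingHom ℚ)).conductorNorm ℤ))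
          (β : ℤ) (ι : K →+* ℂ) (n₁ : ℕ) (d : KolyvaginHeegnerData Dt β ι n₁), Squarefree n₁ ∧
          (∀ q ∈ n₁.primeFactors, Zhang2014.IsKolyvaginPrime (((⟨0, 1, 1, -12, 12⟩ : WeierstrassCurve ℤ).map (Int.castRingHom ℚ)).conductorNorm ℤ)
            ((⟨0, 1, 1, -12, 12⟩ : WeierstrassCurve ℤ).map (Int.castRingHom ℚ)) K p q) ∧
          d.kolyvaginClass hp.out 1 ≠ 0 ∧
          (n₁.primeFactors.card + 1 ≤ ((⟨0, 1, 1, -12, 12⟩ : WeierstrassCurve ℤ).map (Int.castRingHom ℚ)).mordellWeilRank ∨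
            (n₁.primeFactors.card ≤ ((⟨0, 1, 1, -12, 12⟩ : WeierstrassCurve ℤ).map (Int.castRingHom ℚ)).mordellWeilRank ∧
              n₁.primeFactors.card + 1 ≤ (((⟨0, 1, 1, -12, 12⟩ : WeierstrassCurve ℤ).map (Int.castRingHom ℚ)).quadraticTwist
                (NumberField.discr K : ℚ)).mordellWeilRank)) := by
  haveI := isElliptic_c707a1
  haveI := isGloballyMinimal_c707a1
  haveI iNZ : NeZero (((⟨0, 1, 1, -12, 12⟩ : WeierstrassCurve ℤ).map (Int.castRingHom ℚ)).conductorNorm ℤ) :=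
    neZero_conductorNorm_of_isElliptic _
  haveI := minTwist19_isElliptic
  haveI := minTwist19_isGloballyMinimal
  haveI iNZT : NeZero (((⟨0, -1, 1, -4452, -110483⟩ : WeierstrassCurve ℤ).map (Int.castRingHom ℚ)).conductorNorm ℤ) :=
    neZero_conductorNorm_of_isElliptic _
  haveI iP := Fact.mk (by norm_num : Nat.Prime 11)
  haveI : NeZero (591251 : ℕ) := ⟨by norm_num⟩
  have hsp := spadeOne_of_five_le 11 (by norm_num)
  have hS2 : ¬ Squarefree (((⟨0, 1, 1, -12, 12⟩ : WeierstrassCurve ℤ).map (Int.castRingHom ℚ)).conductorNorm ℤ) →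
      (∃ (ℓ : ℕ) (_ : Fact ℓ.Prime), ((⟨0, 1, 1, -12, 12⟩ : WeierstrassCurve ℤ).map (Int.castRingHom ℚ)).HasMultiplicativeReductionAtPrime ℓ ∧
          ¬ 11 ∣ padicValInt ℓ ((⟨0, 1, 1, -12, 12⟩ : WeierstrassCurve ℤ).map (Int.castRingHom ℚ)).minimalDiscriminantInt) ∧
        ∃ (ℓ₁ ℓ₂ : ℕ) (_ : Fact ℓ₁.Prime) (_ : Fact ℓ₂.Prime), ℓ₁ ≠ ℓ₂ ∧
          ((⟨0, 1, 1, -12, 12⟩ : WeierstrassCurve ℤ).map (Int.castRingHom ℚ)).HasMultiplicativeReductionAtPrime ℓ₁ ∧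
          ((⟨0, 1, 1, -12, 12⟩ : WeierstrassCurve ℤ).map (Int.castRingHom ℚ)).HasMultiplicativeReductionAtPrime ℓ₂ :=
    fun hns ↦ absurd ((((⟨0, 1, 1, -12, 12⟩ : WeierstrassCurve ℤ).map (Int.castRingHom ℚ))).isSemistable_iff_squarefree_conductorNorm.mp hsp.2) hns
  have hH := satisfiesHeegnerHypothesis_conductorNorm_of_intModel intModel K hK.1 hD heegner_neg19
  have hD3 : NumberField.discr K ≠ -3 := by rw [hD]; norm_num
  have hD4 : NumberField.discr K ≠ -4 := by rw [hD]; norm_num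
  have hpD : ¬ (((11 : ℕ) : ℤ) ∣ NumberField.discr K) := by rw [hD]; decide
  have hsur : ((⟨0, 1, 1, -12, 12⟩ : WeierstrassCurve ℤ).map (Int.castRingHom ℚ)).HasSurjectiveModNGaloisRep ((11 : ℕ) : ℤ) := by
    simpa using hasSurjectiveModNGaloisRep_11
  have htower : ∀ k : ℕ, ((⟨0, 1, 1, -12, 12⟩ : WeierstrassCurve ℤ).map (Int.castRingHom ℚ)).HasSurjectiveModNGaloisRep ((11 : ℕ) ^ k : ℕ) :=
    serre_hasSurjectiveModNGaloisRep_pow_holds _ 11 (by norm_num) hsur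
  have hC : (⟨1, (-6 : ℚ), (0 : ℚ), -((1 : ℚ) / 2)⟩ : WeierstrassCurve.VariableChange ℚ) •
      ((⟨0, -1, 1, -4452, -110483⟩ : WeierstrassCurve ℤ).map (Int.castRingHom ℚ)) =
      ((⟨0, 1, 1, -12, 12⟩ : WeierstrassCurve ℤ).map (Int.castRingHom ℚ)).quadraticTwist (NumberField.discr K : ℚ) := by
    rw [hD]; push_cast; exact minTwist19_smul_eq
  have hrank : 2 ≤ ((⟨0, 1, 1, -12, 12⟩ : WeierstrassCurve ℤ).map (Int.castRingHom ℚ)).mordellWeilRank :=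
    KernelCerts002.C707a1.two_le_rank
  have hν' : (591251 : ℕ).primeFactors.card ≤ ((⟨0, 1, 1, -12, 12⟩ : WeierstrassCurve ℤ).map (Int.castRingHom ℚ)).mordellWeilRank := by
    refine le_trans (le_of_eq ?_) hrank
    rw [show (591251 : ℕ) = 463 * 1277 from rfl, Nat.primeFactors_mul (by norm_num) (by norm_num),
      Nat.Prime.primeFactors (by norm_num), Nat.Prime.primeFactors (by norm_num)]
    decide
  have hμ' : m.primeFactors.card ≤ ((⟨0, 1, 1, -12, 12⟩ : WeierstrassCurve ℤ).map (Int.castRingHom ℚ)).mordellWeilRank := hμ.trans hrank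
  exact cruxBody_of_kuriharaClaims_spade hKim hnf hMaz h84 _ hrank 11 (by norm_num) goodOrdinary_11.1 goodOrdinary_11.2 htower
    (kodairaNeron_of_five_le 11 (by norm_num)) nonAnomalous_11 hsp.1 hS2 K hK hD3 hD4 hpD hH 591251 isCyclicKolyvaginLevel_11_591251 hν' hδE
    ((⟨0, -1, 1, -4452, -110483⟩ : WeierstrassCurve ℤ).map (Int.castRingHom ℚ)) _ hC minTwist19_nonAnomalous_11
    minTwist19_kodairaNeron_11 m hm hμ' hδT

end C707a1

end Summit.BirchSwinnertonDyer.BirchSwinnertonDyer.Theorems.KolyvaginDepthDoor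

end
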